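import Summits.NavierStokesRegularity.NavierStokesRegularity.Theorems.TerminalTraceTypeITraceScarL3StubCentreEnstrophyAtDepth
import Summits.NavierStokesRegularity.NavierStokesRegularity.Theorems.TerminalTraceTypeITraceScarL3StubQuietShellNoConcentration
import HarnessLib

/-!
# No QUIET-SHELL extinct Type-I apex — v3's Stub QA `stub_no_quietShellExtinctApex` of line `annulus-dichotomy`,
# now UNCONDITIONAL (item `TerminalTrace.TypeITraceScarL3`, stmt-NavierStokesRegularity-18385)

Seat nsreg-C26-p1 (prover), `--supports stmt-NavierStokesRegularity-18385` (helper).  Modus ponens over the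
tree, route-independent (no `Theses` import): the registered stubs Q1 `stub_centreEnstrophyAtDepth` (p593596)
and Q234 `stub_quietShell_noConcentration` (p596546) of skeleton v4 (sha16 3f7a14107033987a) give v3's QA
statement with NO hypothesis left — for every class `(M, D₀, C)` there is a ratio `A₀ > 1` such that an extinct
Type-I apex of the class (suitable in every `Q(a)`, weak gradient, `𝐈 ≤ M`, `D ≤ D₀` at apices `≤ 0`, rate
`C/√(−s)`, weakly null at the top) which is essentially bounded on a late shell `]−δ, 0[ × {R < |y| < A₀ R}`
is NOT backward-singular at the origin (same composition as ns-typeII-p3 g10's conditional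
`no_quietShellExtinctApex_of_Qstubs`, restated here to stay out of the route cone).

WHAT THIS IS NOT: not the LOUD stub `stub_no_loudShellExtinctApex` (the open core), not item 18385, no
statement about Navier–Stokes regularity (NOT proved).
[folklore; Tao2021 §5; EscauriazaSereginSverak2003 §3–§5; AlbrittonBarker2019 §3]
-/

noncomputable section

set_option linter.dupNamespace false

namespace Summit.NavierStokesRegularity.NavierStokesRegularity.Theorems.TypeITraceScarL3

open MeasureTheory Set Function Filter Topology TopologicalSpace Metric InnerProductSpace
open Literature.Analysis Literature.Analysis.FluidPDE
open scoped NNReal ENNReal RealInnerProductSpace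

/-- **No quiet-shell extinct Type-I apex** (v3's Stub QA of line `annulus-dichotomy`, unconditional): obtain
`(κ₀, c₂)` from Q1 `stub_centreEnstrophyAtDepth`, then `A₀` from Q234 `stub_quietShell_noConcentration`, then
modus ponens. [folklore; Tao2021 §5; EscauriazaSereginSverak2003 §3–§5] -/
theorem no_quietShellExtinctApex :
    ∀ (M D₀ : ℝ≥0) (C : ℝ), ∃ A₀ : ℝ, 1 < A₀ ∧
    ∀ (U : ℝ → EuclideanSpace ℝ (Fin 3) → EuclideanSpace ℝ (Fin 3))
      (P : ℝ → EuclideanSpace ℝ (Fin 3) → ℝ)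
      (G : ℝ → EuclideanSpace ℝ (Fin 3) →
        EuclideanSpace ℝ (Fin 3) →L[ℝ] EuclideanSpace ℝ (Fin 3)),
      (∀ a : ℝ, 0 < a →
        IsSuitableWeakSolutionInBall a (0 : ℝ × EuclideanSpace ℝ (Fin 3)) U P) →
      (∀ a : ℝ, 0 < a →
        HasWeakSpatialGradientOn
          (parabolicCylinderOpens a (0 : ℝ × EuclideanSpace ℝ (Fin 3))) U G) →
      (∀ a : ℝ, 0 < a →
        typeIBound (parabolicCylinder a (0 : ℝ × EuclideanSpace ℝ (Fin 3))) U P G ≤ M) →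
      (∀ z₀ : ℝ × EuclideanSpace ℝ (Fin 3), z₀.1 ≤ 0 →
        ∀ r : ℝ, 0 < r → cknD r z₀ P ≤ D₀) →
      (∀ s : ℝ, s < 0 →
        ∀ᵐ y : EuclideanSpace ℝ (Fin 3), ‖U s y‖ ≤ C / Real.sqrt (-s)) →
      (∀ φ : EuclideanSpace ℝ (Fin 3) → EuclideanSpace ℝ (Fin 3),
        ContDiff ℝ (⊤ : ℕ∞) φ →
        HasCompactSupport φ → ∀ ε : ℝ, 0 < ε →
        ∃ s₀ : ℝ, s₀ < 0 ∧ ∀ᵐ s ∂(volume.restrict (Ioo s₀ 0)), |∫ y, ⟪U s y, φ y⟫| ≤ ε) →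
      (∃ δ : ℝ, 0 < δ ∧ ∃ R : ℝ, 0 < R ∧ ∃ K : ℝ,
        ∀ᵐ z ∂(volume.restrict
          (Ioo (-δ) 0 ×ˢ {y : EuclideanSpace ℝ (Fin 3) | R < ‖y‖ ∧ ‖y‖ < A₀ * R})),
            ‖U z.1 z.2‖ ≤ K) →
      ¬ IsBackwardSingularPoint U (0 : ℝ × EuclideanSpace ℝ (Fin 3)) := by
  intro M D₀ C
  obtain ⟨κ₀, hκ₀, c₂, hc₂, hc₂', hQ1'⟩ := stub_centreEnstrophyAtDepth M D₀ C
  obtain ⟨A₀, hA₀, hQ234'⟩ := stub_quietShell_noConcentration M D₀ C κ₀ c₂ hκ₀ hc₂ hc₂'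
  refine ⟨A₀, hA₀, fun U P G hsw hG hI hD hrate htop hQA hsing => ?_⟩
  exact hQ234' U P G hsw hG hI hD hrate htop hQA (hQ1' U P G hsw hG hI hD hrate htop hsing)

end Summit.NavierStokesRegularity.NavierStokesRegularity.Theorems.TypeITraceScarL3
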